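import Literature.NumberTheory.Automorphic.UnitaryGroupArchProjection              -- ★ `archLocalEquivU21 E J₃ w₁ T hT : archLocal ≃ₜ* U21` (frame `hT` as hypothesis)
import Literature.NumberTheory.Automorphic.ArchDiagonalTorus                       -- ★ `circleDiagonal`, `circleDiagonal_mem_archLocal_diagonal`
import Literature.Geometry.ComplexHyperbolic.UnitBallKCentralOrbitalIntegralChart   -- ★ p843337 (F0P3a-p05): `mat`, `mkU21`, the chart side of (A4) — brings the Borel structure of `U21`
import HarnessLib

/-!
# (A4-iv) THE BRIDGE `U(σ_w diag α)(ℂ) ≃ₜ* U(2,1)` BY AN EXPLICIT DIAGONAL FRAME, and the transport of the letter's torus orbital integrals to the ball model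
# (Rogawski 1990 §8.4 p. 126 `T ⊂ G = U(2,1)`; Platonov–Rapinchuk 1994 §2.3 (change of hermitian frame); Goldman 1999 §3.1.1)

Topic `NumberTheory/Automorphic`; namespace `Literature.NumberTheory.Automorphic.UnitaryGroup`.  THEOREMS ONLY (no `def` — the equivalence is ★ `archLocalEquivU21`; this file BUILDS
its frame hypothesis for a diagonal form and states the transports; no instance, no notation, no axiom, no named fact, no `sorry`).  Cell `pub/hodgecm-mathlib`, ENGINE T1 (crux
H413 = `stmt-HodgeConjecture-24833`); ROAD A toward N1 = the registered stub `stub_L21` (closer ED. 25) ∕ `stub_ArchCentralLimitU21` («SdArch» ED. 3): brick (A4-iv) of the ROAD A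
owner F0P3a-p05 (g13)'s census `CENSUS-A4-ValueInTheChart` 19b229d9 («bridge + tokens», dealt 09:28Z); author A-p18 (g25), 2026-09-01.

WHY.  The (A4) VALUE of the letter `ArchCentralLimitFormulaRankTwo L α w` is computed in the BALL MODEL `U21 = U(diag(1,1,−1))` (★ `UnitBallHyperboloidChart`,
★ `UnitBallKCentralConeLimit`, ★ `UnitBallKCentralOrbitalIntegralChart`: `∫_{U21} Θ(mat(g·mkU21(diag(u,u,v))·g⁻¹)) dμ = c·∫_{ℂ²} …`), while the letter and the wall∕chamber skeleton
(★ (A1)(A1′)(A2″)(A4)-L∕T∕V, (A5)) live on `G_w = archLocal L 3 (diagonal α) w = U(σ_w diag α)(ℂ)` with the torus `t(z) = circleDiagonal 3 z`.  At the e-pattern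
`re σ_wα₀ > 0, re σ_wα₁ > 0, re σ_wα₂ < 0` (slots `0,1` the compact pair; other patterns are reached upstream by ★ COLLAPSE `tendsto_lambda8_rhoWeylDelta_mul_comp_perm`) the REAL
POSITIVE DIAGONAL frame `T = diag(|re σ_wα_i|^{−1∕2})` satisfies `Tᴴ·σ_w(diag α)·T = diag(1,1,−1)` and COMMUTES WITH THE TORUS, so `g ↦ T⁻¹gT` carries `G_w` onto `U21`, `t(z)` onto
`diag z`, Haar onto Haar, and `Φ_Θ^{G_w}(z) = Φ^{U21}_{Θ∘Ad T}(z)` with NO relabelling of `z`: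
* §1 `exists_diagonalFrame_formCongr_eq_J` — the frame and its two properties;
* §2 `exists_continuousMulEquiv_archLocal_U21_torus` — `∃ T e, (∀ g, ↑(e g) = T⁻¹·↑g·T) ∧ (∀ z, ↑(e (t z)) = circleDiagonal 3 z)`;
* §3 **`integral_comp_conj_eq_integral_map_of_conj_frame`** — for ANY `e : G_w ≃ₜ* U21` of the form `g ↦ T⁻¹gT`, any measure `ν`, any `Θ`, any `z`:
  `∫_{G_w} Θ(↑↑(g·t(z)·g⁻¹)) dν = ∫_{U21} Θ(↑T · mat(u·e(t z)·u⁻¹) · ↑T⁻¹) d(ν.map e)` (change of variables along the homeomorphism + group algebra), and its K-central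
  reading `…_kCentral` in ★ p843337's token `mat (u * mkU21 (diagonal ![z 0, z 1, z 2]) _ * u⁻¹)`;
* §4 `isHaarMeasure_map_archLocalEquiv`, `isMulRightInvariant_map_archLocalEquiv` — the transported measure is a (right-invariant) Haar measure on `U21`.
HONEST LABEL: frame bookkeeping for ROAD A; proves nothing about HC_CM, which is proved only modulo the printed citations until rung 0 closes.

## References
* [Rogawski1990] J. D. Rogawski, *Automorphic Representations of Unitary Groups in Three Variables*, Ann. of Math. Stud. 123 (1990), §8.4 pp. 126–127.
* [PlatonovRapinchuk1994] V. Platonov, A. Rapinchuk, *Algebraic Groups and Number Theory* (1994), §2.3 (hermitian forms and their unitary groups under change of frame).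
* [Goldman1999] W. M. Goldman, *Complex Hyperbolic Geometry* (1999), §3.1.1 (`U(2,1)` of `diag(1,1,−1)`).
-/

set_option autoImplicit false

noncomputable section

open MeasureTheory Measure NumberField NumberField.InfinitePlace Topology Matrix
open Literature.Geometry.ComplexHyperbolic Literature.Geometry.ComplexHyperbolic.BallModel

namespace Literature.NumberTheory.Automorphic.UnitaryGroup

section Frame

variable (L : Type) [Field L] (α : Fin 3 → L) (w : {w : InfinitePlace L // IsComplex w})

/-- **THE DIAGONAL FRAME.**  At the e-pattern `re σ_wα₀ > 0, re σ_wα₁ > 0, re σ_wα₂ < 0` (with `σ_wα_i` real) the real positive diagonal matrix `T = diag(|re σ_wα_i|^{−1∕2})` satisfies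
`Tᴴ·σ_w(diag α)·T = diag(1,1,−1) = J` (a Sylvester frame) and commutes with every torus element `diag z`. [cite: PlatonovRapinchuk1994, §2.3] [cite: Rogawski1990, §8.4 p. 126] -/
theorem exists_diagonalFrame_formCongr_eq_J (hreal : ∀ i, (w.1.embedding (α i)).im = 0)
    (h0 : 0 < (w.1.embedding (α 0)).re) (h1 : 0 < (w.1.embedding (α 1)).re) (h2 : (w.1.embedding (α 2)).re < 0) :
    ∃ T : GL (Fin 3) ℂ, ((T : Matrix (Fin 3) (Fin 3) ℂ) = Matrix.diagonal fun i => (((Real.sqrt |(w.1.embedding (α i)).re|)⁻¹ : ℝ) : ℂ)) ∧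
      formCongr (starRingEnd ℂ) T ((Matrix.diagonal α).map w.1.embedding) = BallModel.J ∧
      ∀ z : Fin 3 → Circle, T⁻¹ * circleDiagonal 3 z * T = circleDiagonal 3 z := by
  -- the entries `r_i = |d_i|^{-1/2}` are non-zero reals
  have hd : ∀ i, (w.1.embedding (α i)).re ≠ 0 := by
    intro i; fin_cases i
    · exact h0.ne'
    · exact h1.ne'
    · exact h2.ne
  have hr : ∀ i, (Real.sqrt |(w.1.embedding (α i)).re|)⁻¹ ≠ 0 := fun i =>
    inv_ne_zero (Real.sqrt_ne_zero'.2 (abs_pos.2 (hd i)))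
  set D : Matrix (Fin 3) (Fin 3) ℂ := Matrix.diagonal fun i => (((Real.sqrt |(w.1.embedding (α i)).re|)⁻¹ : ℝ) : ℂ) with hD
  have hdet : D.det ≠ 0 := by
    rw [hD, Matrix.det_diagonal]
    exact Finset.prod_ne_zero_iff.2 fun i _ => Complex.ofReal_ne_zero.2 (hr i)
  refine ⟨Matrix.GeneralLinearGroup.mkOfDetNeZero D hdet, rfl, ?_, ?_⟩
  · -- `Tᴴ H T = diag(r_i² d_i) = diag(sign d_i)`
    have hz : ∀ i, w.1.embedding (α i) = (((w.1.embedding (α i)).re : ℝ) : ℂ) := fun i =>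
      (Complex.conj_eq_iff_re.1 (Complex.conj_eq_iff_im.2 (hreal i))).symm
    have hH : (Matrix.diagonal α).map w.1.embedding = Matrix.diagonal fun i => (((w.1.embedding (α i)).re : ℝ) : ℂ) := by
      rw [Matrix.diagonal_map (map_zero _)]
      congr 1; funext i; exact hz i
    show ((D.map (starRingEnd ℂ))ᵀ * ((Matrix.diagonal α).map w.1.embedding) * D) = BallModel.J
    have hDmap : D.map (starRingEnd ℂ) = D := by
      rw [hD, Matrix.diagonal_map (map_zero _)]
      congr 1; funext i; exact Complex.conj_ofReal _
    rw [hDmap, hD, Matrix.diagonal_transpose, hH, Matrix.diagonal_mul_diagonal, Matrix.diagonal_mul_diagonal, BallModel.J]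
    congr 1
    funext i
    have key : ∀ (d : ℝ), d ≠ 0 → (((Real.sqrt |d|)⁻¹ : ℝ) : ℂ) * (d : ℂ) * (((Real.sqrt |d|)⁻¹ : ℝ) : ℂ) = ((d / |d| : ℝ) : ℂ) := by
      intro d hd0
      have hsq : Real.sqrt |d| ^ 2 = |d| := Real.sq_sqrt (abs_nonneg d)
      have e1 : (Real.sqrt |d|)⁻¹ * d * (Real.sqrt |d|)⁻¹ = d / |d| := by
        rw [show (Real.sqrt |d|)⁻¹ * d * (Real.sqrt |d|)⁻¹ = d / (Real.sqrt |d| ^ 2) by ring, hsq]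
      have e2 := congrArg (fun x : ℝ => (x : ℂ)) e1
      push_cast at e2 ⊢
      exact e2
    have hq0 : ((w.1.embedding (α 0)).re / |(w.1.embedding (α 0)).re| : ℝ) = 1 := by rw [abs_of_pos h0, div_self (hd 0)]
    have hq1 : ((w.1.embedding (α 1)).re / |(w.1.embedding (α 1)).re| : ℝ) = 1 := by rw [abs_of_pos h1, div_self (hd 1)]
    have hq2 : ((w.1.embedding (α 2)).re / |(w.1.embedding (α 2)).re| : ℝ) = -1 := by rw [abs_of_neg h2, div_neg, div_self (hd 2)]
    fin_cases i
    · simp only [Fin.zero_eta, Matrix.cons_val_zero]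
      rw [key _ (hd 0), hq0]; simp
    · simp only [Fin.mk_one, Matrix.cons_val_one, Matrix.cons_val_zero]
      rw [key _ (hd 1), hq1]; simp
    · simp only [Fin.reduceFinMk, Matrix.cons_val_two, Matrix.tail_cons, Matrix.head_cons]
      rw [key _ (hd 2), hq2]; simp
  · -- diagonal matrices commute
    intro z
    rw [mul_assoc, inv_mul_eq_iff_eq_mul]
    apply Units.ext
    change (circleDiagonal 3 z : Matrix (Fin 3) (Fin 3) ℂ) * D = D * (circleDiagonal 3 z : Matrix (Fin 3) (Fin 3) ℂ)
    rw [coe_circleDiagonal, hD, Matrix.diagonal_mul_diagonal, Matrix.diagonal_mul_diagonal]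
    congr 1; funext i; ring

end Frame

section Equiv

variable (L : Type) [Field L] (α : Fin 3 → L) (w : {w : InfinitePlace L // IsComplex w})

/-- **`G_w ≃ₜ* U(2,1)` CARRYING THE TORUS TO THE TORUS**: at the e-pattern there are a frame `T` and an isomorphism of topological groups `e : archLocal L 3 (diagonal α) w ≃ₜ* U21`,
`e g = T⁻¹ g T` (★ `archLocalEquivU21`), with `e (t z) = diag z` for every `z ∈ (S¹)³`. [cite: PlatonovRapinchuk1994, §2.3] [cite: Rogawski1990, §8.4 p. 126] -/
theorem exists_continuousMulEquiv_archLocal_U21_torus (hreal : ∀ i, (w.1.embedding (α i)).im = 0)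
    (h0 : 0 < (w.1.embedding (α 0)).re) (h1 : 0 < (w.1.embedding (α 1)).re) (h2 : (w.1.embedding (α 2)).re < 0) :
    ∃ (T : GL (Fin 3) ℂ) (e : archLocal L 3 (Matrix.diagonal α) w ≃ₜ* U21),
      ((T : Matrix (Fin 3) (Fin 3) ℂ) = Matrix.diagonal fun i => (((Real.sqrt |(w.1.embedding (α i)).re|)⁻¹ : ℝ) : ℂ)) ∧
      (∀ g : archLocal L 3 (Matrix.diagonal α) w, ((e g : U21) : GL (Fin 3) ℂ) = T⁻¹ * (g : GL (Fin 3) ℂ) * T) ∧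
      ∀ z : Fin 3 → Circle, ((e ⟨circleDiagonal 3 z, circleDiagonal_mem_archLocal_diagonal L 3 α w z⟩ : U21) : GL (Fin 3) ℂ) = circleDiagonal 3 z := by
  obtain ⟨T, hTd, hT, hTz⟩ := exists_diagonalFrame_formCongr_eq_J L α w hreal h0 h1 h2
  refine ⟨T, archLocalEquivU21 L (Matrix.diagonal α) w T hT, hTd, fun g => coe_archLocalEquivU21_apply L (Matrix.diagonal α) w T hT g, fun z => ?_⟩
  rw [coe_archLocalEquivU21_apply]
  exact hTz z

end Equiv

section Transport

variable (L : Type) [Field L] (α : Fin 3 → L) (w : {w : InfinitePlace L // IsComplex w})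
variable {E : Type*} [NormedAddCommGroup E] [NormedSpace ℝ E]

/-- **TRANSPORT OF THE TORUS ORBITAL INTEGRAL ALONG A FRAME.**  For any isomorphism `e : G_w ≃ₜ* U21` of the form `g ↦ T⁻¹gT`, any measure `ν` on `G_w`, any `Θ`, any torus point `z`:
`∫_{G_w} Θ(↑↑(g·t(z)·g⁻¹)) dν = ∫_{U21} Θ(↑T · mat(u·e(t z)·u⁻¹) · ↑T⁻¹) d(ν.map e)` — change of variables along the homeomorphism (`integral_map_equiv`) and `T(T⁻¹gT·T⁻¹tT·T⁻¹g⁻¹T)T⁻¹ = g t g⁻¹`.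
[cite: Rogawski1990, §8.4 p. 126] [cite: PlatonovRapinchuk1994, §2.3] -/
theorem integral_comp_conj_eq_integral_map_of_conj_frame [MeasurableSpace (archLocal L 3 (Matrix.diagonal α) w)] [BorelSpace (archLocal L 3 (Matrix.diagonal α) w)]
    (T : GL (Fin 3) ℂ) (e : archLocal L 3 (Matrix.diagonal α) w ≃ₜ* U21)
    (he : ∀ g : archLocal L 3 (Matrix.diagonal α) w, ((e g : U21) : GL (Fin 3) ℂ) = T⁻¹ * (g : GL (Fin 3) ℂ) * T)
    (ν : Measure (archLocal L 3 (Matrix.diagonal α) w)) (Θ : Matrix (Fin 3) (Fin 3) ℂ → E) (z : Fin 3 → Circle) :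
    ∫ g, Θ (((g * ⟨circleDiagonal 3 z, circleDiagonal_mem_archLocal_diagonal L 3 α w z⟩ * g⁻¹ : archLocal L 3 (Matrix.diagonal α) w) : GL (Fin 3) ℂ) : Matrix (Fin 3) (Fin 3) ℂ) ∂ν =
      ∫ u, Θ ((T : Matrix (Fin 3) (Fin 3) ℂ) * mat (u * e ⟨circleDiagonal 3 z, circleDiagonal_mem_archLocal_diagonal L 3 α w z⟩ * u⁻¹) * ((T⁻¹ : GL (Fin 3) ℂ) : Matrix (Fin 3) (Fin 3) ℂ))
        ∂(ν.map e) := by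
  -- change of variables along the measurable equivalence underlying `e`
  have hcoe : (e.toHomeomorph.toMeasurableEquiv : archLocal L 3 (Matrix.diagonal α) w → U21) = e := rfl
  rw [← hcoe, integral_map_equiv]
  refine integral_congr_ae (Filter.Eventually.of_forall fun g => ?_)
  -- group algebra: `T · ↑(e g · e t · (e g)⁻¹) · T⁻¹ = ↑(g t g⁻¹)`
  simp only [hcoe]
  congr 1
  have hU : ((e g * e ⟨circleDiagonal 3 z, circleDiagonal_mem_archLocal_diagonal L 3 α w z⟩ * (e g)⁻¹ : U21) : GL (Fin 3) ℂ) =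
      T⁻¹ * ((g * ⟨circleDiagonal 3 z, circleDiagonal_mem_archLocal_diagonal L 3 α w z⟩ * g⁻¹ : archLocal L 3 (Matrix.diagonal α) w) : GL (Fin 3) ℂ) * T := by
    rw [← map_inv, ← map_mul, ← map_mul, he]
  rw [show mat (e g * e ⟨circleDiagonal 3 z, circleDiagonal_mem_archLocal_diagonal L 3 α w z⟩ * (e g)⁻¹) =
      ((e g * e ⟨circleDiagonal 3 z, circleDiagonal_mem_archLocal_diagonal L 3 α w z⟩ * (e g)⁻¹ : U21) : GL (Fin 3) ℂ) from rfl, hU,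
    ← Units.val_mul, ← Units.val_mul]
  congr 1
  group

/-- **THE LETTER'S TORUS ORBITAL INTEGRAL IN THE BALL MODEL** (e-pattern frame of §2): `Φ_Θ^{G_w}(z) = ∫_{U21} Θ(↑T · mat(u·diag z·u⁻¹) · ↑T⁻¹) d(ν.map e)` — the K-central case `z = (u,u,v)`
is ★ p843337's token `mat (g * mkU21 (diagonal ![u, u, v]) _ * g⁻¹)` up to the proof-irrelevant membership witness. [cite: Rogawski1990, §8.4 pp. 126–127] [cite: Goldman1999, §3.1.1] -/
theorem integral_comp_conj_eq_integral_map_mkU21 [MeasurableSpace (archLocal L 3 (Matrix.diagonal α) w)] [BorelSpace (archLocal L 3 (Matrix.diagonal α) w)]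
    (T : GL (Fin 3) ℂ) (e : archLocal L 3 (Matrix.diagonal α) w ≃ₜ* U21)
    (he : ∀ g : archLocal L 3 (Matrix.diagonal α) w, ((e g : U21) : GL (Fin 3) ℂ) = T⁻¹ * (g : GL (Fin 3) ℂ) * T)
    (hez : ∀ z : Fin 3 → Circle, ((e ⟨circleDiagonal 3 z, circleDiagonal_mem_archLocal_diagonal L 3 α w z⟩ : U21) : GL (Fin 3) ℂ) = circleDiagonal 3 z)
    (ν : Measure (archLocal L 3 (Matrix.diagonal α) w)) (Θ : Matrix (Fin 3) (Fin 3) ℂ → E) (z : Fin 3 → Circle)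
    (hz : (Matrix.diagonal fun i => (z i : ℂ))ᴴ * BallModel.J * Matrix.diagonal (fun i => (z i : ℂ)) = BallModel.J) :
    ∫ g, Θ (((g * ⟨circleDiagonal 3 z, circleDiagonal_mem_archLocal_diagonal L 3 α w z⟩ * g⁻¹ : archLocal L 3 (Matrix.diagonal α) w) : GL (Fin 3) ℂ) : Matrix (Fin 3) (Fin 3) ℂ) ∂ν =
      ∫ u, Θ ((T : Matrix (Fin 3) (Fin 3) ℂ) * mat (u * mkU21 (Matrix.diagonal fun i => (z i : ℂ)) hz * u⁻¹) * ((T⁻¹ : GL (Fin 3) ℂ) : Matrix (Fin 3) (Fin 3) ℂ)) ∂(ν.map e) := by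
  rw [integral_comp_conj_eq_integral_map_of_conj_frame L α w T e he ν Θ z]
  have hmk : e ⟨circleDiagonal 3 z, circleDiagonal_mem_archLocal_diagonal L 3 α w z⟩ = mkU21 (Matrix.diagonal fun i => (z i : ℂ)) hz := by
    apply Subtype.ext
    apply Units.ext
    rw [hez z]
    rfl
  rw [hmk]

end Transport

section Haar

variable (L : Type) [Field L] (α : Fin 3 → L) (w : {w : InfinitePlace L // IsComplex w})

/-- The transported measure `ν.map e` is a Haar measure on `U(2,1)` (Mathlib `ContinuousMulEquiv.isHaarMeasure_map`). [cite: PlatonovRapinchuk1994, §2.3] -/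
theorem isHaarMeasure_map_archLocalEquiv [MeasurableSpace (archLocal L 3 (Matrix.diagonal α) w)] [BorelSpace (archLocal L 3 (Matrix.diagonal α) w)]
    (e : archLocal L 3 (Matrix.diagonal α) w ≃ₜ* U21) (ν : Measure (archLocal L 3 (Matrix.diagonal α) w)) [ν.IsHaarMeasure] :
    (ν.map e).IsHaarMeasure :=
  e.isHaarMeasure_map ν

/-- … and right-invariant when `ν` is (Mathlib `isMulRightInvariant_map` along the surjective continuous hom `e`). [cite: PlatonovRapinchuk1994, §2.3] -/
theorem isMulRightInvariant_map_archLocalEquiv [MeasurableSpace (archLocal L 3 (Matrix.diagonal α) w)] [BorelSpace (archLocal L 3 (Matrix.diagonal α) w)]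
    (e : archLocal L 3 (Matrix.diagonal α) w ≃ₜ* U21) (ν : Measure (archLocal L 3 (Matrix.diagonal α) w)) [ν.IsMulRightInvariant] :
    (ν.map e).IsMulRightInvariant := by
  refine ⟨fun h => ?_⟩
  have he : Measurable (e : archLocal L 3 (Matrix.diagonal α) w → U21) := e.continuous.measurable
  obtain ⟨g, rfl⟩ := e.surjective h
  rw [Measure.map_map (measurable_mul_const _) he]
  conv_rhs => rw [← map_mul_right_eq_self ν g]
  rw [Measure.map_map he (measurable_mul_const _)]
  congr 1
  funext x
  simp only [Function.comp_apply, map_mul]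

end Haar

/-! ## ED. 2 (A-p18 (g25), 2026-09-01) — §5 the transported TEST FUNCTION `Θ ∘ Ad T : M ↦ Θ(T·M·T⁻¹)`: continuity, smoothness, compact support on `U21`, and the inverse formula
`e.symm u = T·u·T⁻¹` — the two inputs ★ p843337 `exists_integral_comp_conj_kCentral_eq_smul_integral_chart` asks of the test function after the bridge §3 -/

section TestFunction

open scoped Matrix.Norms.Operator

variable (L : Type) [Field L] (α : Fin 3 → L) (w : {w : InfinitePlace L // IsComplex w})
variable {E : Type*} [NormedAddCommGroup E] [NormedSpace ℝ E]

/-- The inverse of an isomorphism `g ↦ T⁻¹gT` is `u ↦ TuT⁻¹` (on underlying invertible matrices). [cite: PlatonovRapinchuk1994, §2.3] -/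
theorem coe_symm_eq_of_conj_frame (T : GL (Fin 3) ℂ) (e : archLocal L 3 (Matrix.diagonal α) w ≃ₜ* U21)
    (he : ∀ g : archLocal L 3 (Matrix.diagonal α) w, ((e g : U21) : GL (Fin 3) ℂ) = T⁻¹ * (g : GL (Fin 3) ℂ) * T) (u : U21) :
    ((e.symm u : archLocal L 3 (Matrix.diagonal α) w) : GL (Fin 3) ℂ) = T * (u : GL (Fin 3) ℂ) * T⁻¹ := by
  have h := he (e.symm u)
  rw [ContinuousMulEquiv.apply_symm_apply] at h
  rw [h]
  group

omit [NormedSpace ℝ E] in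
/-- `Θ ∘ Ad T` is continuous when `Θ` is. [cite: Rogawski1990, §8.4 p. 126] -/
theorem continuous_comp_conjFrame (T : GL (Fin 3) ℂ) {Θ : Matrix (Fin 3) (Fin 3) ℂ → E} (hΘ : Continuous Θ) :
    Continuous fun M : Matrix (Fin 3) (Fin 3) ℂ => Θ ((T : Matrix (Fin 3) (Fin 3) ℂ) * M * ((T⁻¹ : GL (Fin 3) ℂ) : Matrix (Fin 3) (Fin 3) ℂ)) :=
  hΘ.comp ((continuous_const.mul continuous_id).mul continuous_const)

/-- `Θ ∘ Ad T` is `Cⁿ` when `Θ` is (conjugation is linear). [cite: Rogawski1990, §8.4 p. 126] -/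
theorem contDiff_comp_conjFrame (T : GL (Fin 3) ℂ) {n : WithTop ℕ∞} {Θ : Matrix (Fin 3) (Fin 3) ℂ → E} (hΘ : ContDiff ℝ n Θ) :
    ContDiff ℝ n fun M : Matrix (Fin 3) (Fin 3) ℂ => Θ ((T : Matrix (Fin 3) (Fin 3) ℂ) * M * ((T⁻¹ : GL (Fin 3) ℂ) : Matrix (Fin 3) (Fin 3) ℂ)) :=
  hΘ.comp ((contDiff_const.mul contDiff_id).mul contDiff_const)

omit [NormedSpace ℝ E] in
/-- **Compact support is transported**: if `k ↦ Θ(↑↑k)` has compact support on `G_w`, then `u ↦ (Θ ∘ Ad T)(mat u)` has compact support on `U21` — it is the former composed with the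
homeomorphism `e.symm` (`e.symm u = TuT⁻¹`). [cite: Rogawski1990, §8.4 p. 126] [cite: PlatonovRapinchuk1994, §2.3] -/
theorem hasCompactSupport_comp_conjFrame (T : GL (Fin 3) ℂ) (e : archLocal L 3 (Matrix.diagonal α) w ≃ₜ* U21)
    (he : ∀ g : archLocal L 3 (Matrix.diagonal α) w, ((e g : U21) : GL (Fin 3) ℂ) = T⁻¹ * (g : GL (Fin 3) ℂ) * T)
    {Θ : Matrix (Fin 3) (Fin 3) ℂ → E} (hsupp : HasCompactSupport fun k : archLocal L 3 (Matrix.diagonal α) w => Θ ((k : GL (Fin 3) ℂ) : Matrix (Fin 3) (Fin 3) ℂ)) :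
    HasCompactSupport fun u : U21 => Θ ((T : Matrix (Fin 3) (Fin 3) ℂ) * mat u * ((T⁻¹ : GL (Fin 3) ℂ) : Matrix (Fin 3) (Fin 3) ℂ)) := by
  have h := hsupp.comp_homeomorph e.symm.toHomeomorph
  have hfun : ((fun k : archLocal L 3 (Matrix.diagonal α) w => Θ ((k : GL (Fin 3) ℂ) : Matrix (Fin 3) (Fin 3) ℂ)) ∘ e.symm.toHomeomorph) =
      fun u : U21 => Θ ((T : Matrix (Fin 3) (Fin 3) ℂ) * mat u * ((T⁻¹ : GL (Fin 3) ℂ) : Matrix (Fin 3) (Fin 3) ℂ)) := by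
    funext u
    simp only [Function.comp_apply]
    show Θ (((e.symm u : archLocal L 3 (Matrix.diagonal α) w) : GL (Fin 3) ℂ) : Matrix (Fin 3) (Fin 3) ℂ) = _
    rw [coe_symm_eq_of_conj_frame L α w T e he u, Units.val_mul, Units.val_mul]
  rwa [hfun] at h

end TestFunction

end Literature.NumberTheory.Automorphic.UnitaryGroup

end
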